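import Summits.ResolutionOfSingularities.ResolutionOfSingularities.Theorems.DeltaCutChainCertificates2
import Summits.ResolutionOfSingularities.ResolutionOfSingularities.Theorems.DeltaCutRunCertificates
import Summits.ResolutionOfSingularities.ResolutionOfSingularities.Theorems.Rescue.BedZpeBinom4Centre
import HarnessLib

/-!
# DeltaCutSepCertificates — decomp-res node «SepCut» (lens-6 g26, critic row 196 CLEARED +1), tree file 4/8 of the node

Content VERBATIM from the decomp-res lens-6 g26 node `HOME/decomp-res-lens-6/g26/SepCut.lean` (pin f15f025c; no
carry, imports the landed tree only); HOME = run/shared/lean/pub/decomp-res; critic row 196 CLEARED +1; landing plan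
NEXT-g27.md fb3fac1c §4 + rider INBOX :1178 — provenance, critic text and the lens header in full in the first file
of the node, `DeltaCutSep`.  Namespace `…Theorems.DeltaCutClasses`; `--supports stmt-ResolutionOfSingularities-26971`.

## This file

§SepCertificates — KERNEL CERTIFICATES of the separating-run cut (node l. 651–1818; polynomial level, char 3, `n =
3`, LEVEL-INDEXED, format of g23–g25 certificates; dictionary in the section docstring: g25's + (L) linear-centre
Rees charts `linChartSubst` + (R) regularity facts): P∞ = `z³ + s·u²·w` LEVEL-GENERIC (`Pinf_top` complete
enumeration of the order-3 primes = s-axis ∪ w-axis, `Pinf_tame_sAxis/wAxis`, `Pinf_wild`, `Pinf_near`, all four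
point charts, uniform law `Pinf_perpetual_certificate [CharP K 3]` = the g25 RESIDUAL kind B INHABITED, and
g26-DECIDED at sep-height 1 `Pinf_sepHeightOne_certificate` — step 2 fires on s̃ ⊔ w̃); C_ax sep-height 1
`Cax_sepHeightOne_certificate`; B_S sep-height 2 `BS_sepHeightTwo_certificate`; C× `SepFrozen` at level 0
`Cx_sepFrozen_certificate` (wild along BOTH axes and V(z,t,uw) irregular at 0 in kernel: `Cx_closure_not_prime`) —
continued in `DeltaCutSepCertificates2`… where the cap cuts.  (This first part carries: `mem_of_sMul_mem_cube`,
`not_mem_span_of_eval`, `sMul_not_mem_sq_of_pderiv_eq_one`, `Pinf_top`, `Pinf_mem_cube_sAxis`,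
`Pinf_mem_cube_wAxis`, `Pinf_axes_nondegenerate`, `Pinf_wild`, `Pinf_dd`, `Pinf_tame_wAxis`, `Pinf_tame_sAxis`,
`chartSubst`, `Pinf_chart_s`, `Pinf_chart_w`, `Pinf_chart_u`, `Pinf_chart_z`.)

[WRITER NOTE (decomp-res writer g12): file split only (tree files ≤ 400 lines); namespace, sections, section opens
and every declaration exactly as in the lens (the node's HOME-only dupNamespace-linter line is dropped; the two
namespace-level `open …TwistCutClasses` / `open …LightCutClasses` lines of the node are replayed); in the
CERTIFICATES files the lens's five `private` helpers (`mem_of_sMul_mem_cube`, `mul_mem_pow_add`,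
`not_mem_span_of_eval`, `sMul_not_mem_sq_of_pderiv_eq_one`, and `one_not_mem_prime`) lose `private` because their
users now sit in later parts of the split, and `one_not_mem_prime` — statement-identical to the LANDED
`one_not_mem_of_isPrime` of g25 `DeltaCutRunCertificates` (a `dedup.landed` restatement) — is DELETED and its 12
uses cite `one_not_mem_of_isPrime` (hence the extra import `DeltaCutRunCertificates`); likewise `mul_mem_pow_add` —
statement-identical to the LANDED `Rescue.BedZpeBinom4Centre.mul_mem_pow_add` of another hand (cone-free module;
pre-flight `dedup.landed`) — is DELETED, that module imported and `open … (mul_mem_pow_add)` replayed in each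
certificates file so the 6 uses stand verbatim.]

(Sources: Hironaka1967 (characteristic polyhedra); CossartJannsenSaito2020 Def. 3.13 / Thm. 3.14, Ch. 8, Thm. 9.6;
Hironaka1970 (near points / vertices); CossartPiltant2019 Prop. 2.6; CossartPiltant2008 §2; Giraud1975; Hironaka2005
(three key theorems: order under permissible blow-up); EGAIV4 §16–§17; StacksProject 0804 / 0BIQ / 031I; Matsumura1987 §28.)
-/

noncomputable section

open CategoryTheory CategoryTheory.Limits AlgebraicGeometry TopologicalSpace IsLocalRing
open Literature.AlgebraicGeometry.Resolution

universe u

open Summit.ResolutionOfSingularities.ResolutionOfSingularities.Theorems.Rescue.BedZpeBinom4Centre (mul_mem_pow_add)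

namespace Summit.ResolutionOfSingularities.ResolutionOfSingularities.Theorems.DeltaCutClasses

open Summit.ResolutionOfSingularities.ResolutionOfSingularities.Theorems.TwistCutClasses
open Summit.ResolutionOfSingularities.ResolutionOfSingularities.Theorems.LightCutClasses

section SepCertificates

open MvPolynomial
variable {K : Type*} [Field K]

/-! ### §SepCertificates — KERNEL CERTIFICATES (polynomial level, LEVEL-INDEXED, g23/g24/g25 format + two dictionary lines)

Dictionary as in g25 §RunCertificates (`K[z,·,·,·] = MvPolynomial (Fin 4) K`, origin `𝔫₀`, `n = 3`, `char K = 3`,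
«`ord_𝔮 g ≥ m`» =
`∃ s ∉ 𝔮, s·g ∈ 𝔮^m`, Rees charts of a point blow-up, WILD = `3`-power form `z³ + (𝔮⁴)`, NEAR = `f' ∈ 𝔫'³` at a chart origin,
TAME = an absolute differential operator of order `2` extracts `c·e` (`c ∈ {1,2}` a unit) with `e` a REGULAR
PARAMETER at the prime
(`∀ s' ∉ 𝔫, s'·e ∉ 𝔫²`)), plus: (L) the Rees charts of the blow-up of a COORDINATE LINEAR CENTRE `V(x_a : a ∈ A)`: chart `x_e`
(`e ∈ A`) has `x_a' = x_a/x_e (a ∈ A ∖ e)`, the other coordinates unchanged, `f = x_eⁿ·f'`, exceptional parameter `x_e`; (R) a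
coordinate linear subspace is a regular scheme, two DISJOINT ones are, and `V(z, t, u·w)` is NOT regular at the
origin (its local
ring is not a domain: `u·w ∈ J`, `u, w ∉ J`).  SUBSTITUTION IDENTITIES are machine-checked (`aeval (chartSubst e) f
= X e ^ 3 * f'`).

* P∞ = `z³ + s·u²·w` (`0 = z, 1 = s, 2 = u, 3 = w`) — KIND B INHABITED (g25-RESIDUAL) and g26-DECIDED (sep-height 1):
  LEVEL i (every i, by REPRODUCTION): top locus = `s`-axis ∪ `w`-axis (`Pinf_top`: `z, u ∈ 𝔮` and `s ∈ 𝔮 ∨ w ∈ 𝔮`;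
both axes inside:
  `Pinf_mem_cube_sAxis/wAxis`), every top point off the origin TAME (`Pinf_tame_sAxis/wAxis`: `∂_u∂_u f = 2·(s·w)`,
`s·w` a regular
  parameter there), the origin WILD (`Pinf_wild`: `f = z³ + s·u²·w`, `s·u²·w ∈ 𝔫₀⁴`) with near points; point
blow-up: chart `s` and
  chart `w` transforms ARE `f` (`Pinf_chart_s`, `Pinf_chart_w`) — so the chart-`s` and chart-`w` origins `O_s`,
`O_w` are WILD with near
  points (bad) and every other exceptional top point (the line `ℓ = {z' = u' = 0} ⊆ E` minus `O_s, O_w`, read in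
chart `s` as the primes
  `⊇ (X₀,X₁,X₂)` with `X₃ ∉`) is TAME by `Pinf_tame_wAxis` applied to the SAME polynomial; chart `u`: `z'³ +
u·s'·w'` has the chart
  origin as its only top point and it is TAME (`Pinf_chart_u`, `Pinf_chart_u_only`, `∂_{s'}∂_{w'} = u` a regular
parameter); chart `z`:
  no top point (`Pinf_chart_z`, `Pinf_chart_z_noTop`).  Hence bad_{i+1} ∩ π⁻¹(bad point) = {O_s, O_w}: `#bad_i =
2^i`, all levels FINITE
  and NONEMPTY — `RunPerpetual 3 P∞` by LEMMA A (`blowup_badCentre_base_mem`) and induction on `i` (the uniform law).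
  LETTER BINDERS of `WORTopRunHeavy 3` / `WORTopRunPerpetual 3` for P∞ (addressed at the SAME certificate level as
C_ax / B_S / D2 in
  g24/g25): `IsBase` — `Y = 𝔸⁴_k = Spec k[z,s,u,w]`, `k` ANY field of characteristic `3` (regular, separated, of
finite type, every
  component of dimension `4`: dictionary); `IsDatum 3` — the marking `3` is the maximal order: `ord_{𝔫₀} f ≥ 3`
(`Pinf_near`) and
  `ord ≤ 3` EVERYWHERE because the third HASSE derivative `D_z^{(3)} f = 1` is a unit (dictionary, exactly as `ord ≤
n` was read for
  D2 / B_S / C_ax in g24/g25 — first-order derivations cannot see `z³` in characteristic `3`); `TopHeavy` — the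
origin is a CLOSED top
  point WITHOUT absolute maximal contact (WILD: (W) `Pinf_wild`, g23 dictionary); `TopDeltaHeavy` — that wild point
has a NEAR point
  (`O_s`: (N) `Pinf_near` read in chart `s`, whose transform IS `f` by (R) `Pinf_chart_s`); `TopChainHeavy` — the
near point `O_s` is
  itself BAD (wild and δ-heavy, by reproduction), so the origin is chain-heavy (equivalently g25 EXACTNESS
  `topChainHeavy_of_not_runTerminates`); `¬ RunTerminates` — by `RunPerpetual.not_runTerminates` from the perpetual
law above.  So the
  datum `(𝔸⁴_k, (f), 3)` meets EVERY binder of `WORTopRunHeavy 3` and of the kind-B letter `WORTopRunPerpetual 3`,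
and it is NOT in
  g25's decided cell (`RunTerminates` fails): kind B is INHABITED.
  SEPARATING RUN: level 0 ACTIVE (bad₀ = {0}); step 1 = the point blow-up above; step 2: `T₀ ∖ {0}` = the punctured axes, their
  strict transforms `s̃ ⊆ chart s` (`= V(X₀,X₂,X₃)`, `Pinf_mem_cube_sAxis`, `X₁ ∉`) and `w̃ ⊆ chart w` are DISJOINT
coordinate lines
  (regular, (R)): step 2 FIRES and blows up `s̃ ⊔ w̃`; by (L) in chart-`s` coordinates: chart `X₂`: `z³ + s·w'` — NO top point
  (`Pinf_L1_lineChart_X2_noTop`); chart `X₃`: `z³ + s·u'²` — top points = the line `(X₀,X₁,X₂)`, ALL TAME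
(`Pinf_L1_lineChart_X3`:
  `∂∂ = 2·s`, `s` a regular parameter); chart `X₀`: `1 + s·u'²w'` — NO top point (`Pinf_L1_lineChart_X0_noTop`); at
`w̃` the same three
  lemmas with `1 ↔ 3` (`Pinf_symm`).  Points of level 1 off `s̃ ⊔ w̃` keep their (tame) type
(`isAbsContactAt_transform_iff_of_not_mem`).
  So sep-level 1 has NO bad point: `SepTerminates 3 P∞` at height 1 — P∞ ∈ `WORTopRunHeavySepTame 3`'s data.
* C_ax = `z³ + t⁴ + u⁴` — g25 kind A (level 0), g26-DECIDED (sep-height 1): top locus = the `w`-axis `P =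
(X₀,X₁,X₂)` (`Cax_top`,
  `Cax_axis`: `f ∈ P³`, `X₃ ∉ P`) = closure of bad₀ (every closed point of the axis is bad: g24
`Cax_curve_certificate`), a coordinate line
  (regular): level 0 ACTIVE, step 1 blows up the axis, step 2 is empty (`T₀ ∖ axis = ∅`); by (L): chart `t`: `z'³ +
t(1 + u'⁴)` NO
  top point (`Cax_L1_chart_t_noTop`), chart `u` likewise (`Cax_L1_chart_u_noTop`), chart `z`: `1 + z(t'⁴ + u'⁴)` NO top point
  (`Cax_L1_chart_z_noTop`); chart identities `Cax_L1_chart_t/u/z`: sep-level 1 has EMPTY support — `SepTerminates` at height 1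
  (conjunction `Cax_sepHeightOne_certificate`).
* B_S = `z³ + t⁷ + u⁷ + w⁷` — g25 kind A (level 1), g26-DECIDED (sep-height 2): level 0: top = {0} (g24
`BS_isolated`), bad₀ = {0}
  (g24 `BS_chain_certificate`), ACTIVE, step 2 empty; level 1 chart `t` (`f₁ = z'³ + t⁴·h`, `h = 1 + u'⁷ + w'⁷`;
charts `u`, `w` by the
  symmetries in `BS_charts`): top = the exceptional plane `(X₀,X₁)` (`BS_L1_chart_t_top`), `f₁ ∈ (X₀,X₁)³`, `X₂, X₃
∉`, WILD with near
  points everywhere (`BS_L1_plane`), chart `z` no top point (`BS_L1_chart_z_noTop`), so closure bad₁ = the plane =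
`T₁` (regular,
  a projective plane): ACTIVE, step 2 empty; level 2 = blow-up of the plane, by (L) (`BS_L2_planeCharts`): plane-chart `t`:
  `z''³ + t·h` NO top point (`BS_L2_planeChart_t_noTop`), plane-chart `z'`: `1 + z'·t⁴·h` NO top point
(`BS_L2_planeChart_z_noTop`):
  EMPTY support — `SepTerminates` at height 2 (conjunction `BS_sepHeightTwo_certificate`).
* C× = `z³ + t⁴ + u⁴w⁴` — THE KIND-F INHABITANT (`SepFrozen` at height 0): top = `u`-axis ∪ `w`-axis (`Cx_top`;
`Cx_axes`: `f ∈ P_u³`,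
  `f ∈ P_w³`, `u ∉ P_u`, `w ∉ P_w`), WILD along both axes with a near point over EVERY closed point (`Cx_axes`, uniform in the
  cofactor `H`): bad₀ = all closed points of `V(J)`, `J = P_u ⊓ P_w = (z, t, u·w)`, whose reduced closure is NOT
regular at the origin
  (`Cx_closure_not_prime`: `u·w ∈ J`, `u ∉ J`, `w ∉ J`; (R)): level 0 INACTIVE with bad₀ ≠ ∅ (conjunction
`Cx_sepFrozen_certificate`).
* KIND P (`SepPerpetual`): NO inhabitant claimed or known — UNDECIDED (never «expected empty»). -/

/-- `g ∈ 𝔮` from `s·g ∈ 𝔮^3`, `s ∉ 𝔮`. [elementary] [folklore] -/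
theorem mem_of_sMul_mem_cube (𝔮 : Ideal (MvPolynomial (Fin 4) K)) [h𝔮 : 𝔮.IsPrime] {s g : MvPolynomial (Fin 4) K}
    (hs : s ∉ 𝔮) (h : s * g ∈ 𝔮 ^ 3) : g ∈ 𝔮 :=
  (h𝔮.mem_or_mem (Ideal.pow_le_self three_ne_zero h)).resolve_left hs

/-- Non-membership in a span by evaluation at a point killing the generators. [elementary] [folklore] -/
theorem not_mem_span_of_eval (G : Set (MvPolynomial (Fin 4) K)) (v : Fin 4 → K)
    (hG : ∀ g ∈ G, eval v g = 0) {q : MvPolynomial (Fin 4) K} (hq : eval v q ≠ 0) : q ∉ Ideal.span G := fun h => by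
  have hle : Ideal.span G ≤ RingHom.ker (eval v) := Ideal.span_le.2 fun g hg => by
    rw [SetLike.mem_coe, RingHom.mem_ker]; exact hG g hg
  exact hq (RingHom.mem_ker.mp (hle h))

/-- A REGULAR PARAMETER TEST: if `x ∈ 𝔫` with `∂ᵢ x = 1` for a coordinate derivation, then `s'·x ∉ 𝔫²` for `s' ∉ 𝔫`
(`∂ᵢ(s'x) = s' + x·∂ᵢ s' ∈ 𝔫` would put `s'` in `𝔫`). [elementary] [folklore] -/
theorem sMul_not_mem_sq_of_pderiv_eq_one (𝔫 : Ideal (MvPolynomial (Fin 4) K)) (i : Fin 4)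
    {x : MvPolynomial (Fin 4) K} (hx : x ∈ 𝔫) (hdx : pderiv i x = 1) {s' : MvPolynomial (Fin 4) K} (hs' : s' ∉ 𝔫)
    (hmem : s' * x ∈ 𝔫 ^ 2) : False := by
  have hD := derivation_pow_succ_mem (pderiv i : Derivation K (MvPolynomial (Fin 4) K) _) _ 1 hmem
  rw [pow_one, Derivation.leibniz, smul_eq_mul, smul_eq_mul, hdx, mul_one] at hD
  have : s' ∈ 𝔫 := by
    have := Ideal.sub_mem _ hD (Ideal.mul_mem_right (pderiv i s') _ hx)
    rwa [add_sub_cancel_right] at this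
  exact hs' this

/-! #### P∞ = `z³ + s·u²·w` -/

/-- **P∞ — THE TOP LOCUS is the union of the `s`-axis and the `w`-axis**: a prime `𝔮` of order `≥ 3` contains `z`,
`u`, and `s` or
`w` (`∂_w f = s·u²`, then `∂_s`: `u² → u`; `∂_u∂_u f = 2·s·w → s·w`; `z³ = f − s·u²·w`). [new; elementary] [folklore] -/
theorem Pinf_top [CharP K 3] (𝔮 : Ideal (MvPolynomial (Fin 4) K)) [𝔮.IsPrime] {s : MvPolynomial (Fin 4) K} (hs : s ∉ 𝔮)
    (h : s * (X 0 ^ 3 + X 1 * X 2 ^ 2 * X 3 : MvPolynomial (Fin 4) K) ∈ 𝔮 ^ 3) :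
    (X 0 : MvPolynomial (Fin 4) K) ∈ 𝔮 ∧ (X 2 : MvPolynomial (Fin 4) K) ∈ 𝔮 ∧
      ((X 1 : MvPolynomial (Fin 4) K) ∈ 𝔮 ∨ (X 3 : MvPolynomial (Fin 4) K) ∈ 𝔮) := by
  have hs2 : s ^ 2 ∉ 𝔮 := pow_not_mem 𝔮 hs 2
  have hs4 : (s ^ 2) ^ 2 ∉ 𝔮 := pow_not_mem 𝔮 hs2 2
  have h2 : (2 : MvPolynomial (Fin 4) K) ∉ 𝔮 := two_not_mem (K := K) 𝔮
  have e10 := f_ne K (i := 1) (j := 0) (by decide)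
  have e12 := f_ne K (i := 1) (j := 2) (by decide)
  have e13 := f_ne K (i := 1) (j := 3) (by decide)
  have e20 := f_ne K (i := 2) (j := 0) (by decide)
  have e21 := f_ne K (i := 2) (j := 1) (by decide)
  have e23 := f_ne K (i := 2) (j := 3) (by decide)
  have e30 := f_ne K (i := 3) (j := 0) (by decide)
  have e31 := f_ne K (i := 3) (j := 1) (by decide)
  have e32 := f_ne K (i := 3) (j := 2) (by decide)
  have e11 := f_self K 1
  have e22 := f_self K 2
  have e33 := f_self K 3
  -- `u`: `∂_w f = s u²`, `∂_s (s u²) = u²`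
  have d3 : pderiv 3 (X 0 ^ 3 + X 1 * X 2 ^ 2 * X 3 : MvPolynomial (Fin 4) K) = X 1 * X 2 ^ 2 := by
    simp only [map_add, Derivation.leibniz, Derivation.leibniz_pow, smul_eq_mul, nsmul_eq_mul, e30, e31, e32, e33]
    push_cast; ring
  have d31 : pderiv 1 (X 1 * X 2 ^ 2 : MvPolynomial (Fin 4) K) = 1 * X 2 ^ 2 := by
    simp only [Derivation.leibniz, Derivation.leibniz_pow, smul_eq_mul, nsmul_eq_mul, e11, e12]
    push_cast; ring
  have hX2 : (X 2 : MvPolynomial (Fin 4) K) ∈ 𝔮 := by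
    have h3 := sq_mul_deriv_mem_pow 𝔮 h (pderiv 3)
    rw [d3] at h3
    have h31 := sq_mul_deriv_mem_pow 𝔮 h3 (pderiv 1)
    rw [d31] at h31
    exact mem_of_mul_mul_pow_mem_pow 𝔮 one_ne_zero hs4 (one_not_mem_of_isPrime 𝔮) h31
  -- `s ∨ w`: `∂_u f = 2 s u w`, `∂_u (2 s u w) = 2 s w`
  have d2 : pderiv 2 (X 0 ^ 3 + X 1 * X 2 ^ 2 * X 3 : MvPolynomial (Fin 4) K) = 2 * (X 1 * X 2 * X 3) := by
    simp only [map_add, Derivation.leibniz, Derivation.leibniz_pow, smul_eq_mul, nsmul_eq_mul, e20, e21, e22, e23]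
    push_cast; ring
  have d22 : pderiv 2 (2 * (X 1 * X 2 * X 3) : MvPolynomial (Fin 4) K) = 2 * (X 1 * X 3) ^ 1 := by
    simp only [Derivation.leibniz, smul_eq_mul, e21, e22, e23, f_two]
    ring
  have hX13 : (X 1 * X 3 : MvPolynomial (Fin 4) K) ∈ 𝔮 := by
    have h2' := sq_mul_deriv_mem_pow 𝔮 h (pderiv 2)
    rw [d2] at h2'
    have h22 := sq_mul_deriv_mem_pow 𝔮 h2' (pderiv 2)
    rw [d22] at h22
    exact mem_of_mul_mul_pow_mem_pow 𝔮 one_ne_zero hs4 h2 h22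
  -- `z`
  have hf : (X 0 ^ 3 + X 1 * X 2 ^ 2 * X 3 : MvPolynomial (Fin 4) K) ∈ 𝔮 := mem_of_sMul_mem_cube 𝔮 hs h
  have hX0 : (X 0 : MvPolynomial (Fin 4) K) ∈ 𝔮 := by
    refine ‹𝔮.IsPrime›.mem_of_pow_mem 3 ?_
    have := Ideal.sub_mem _ hf (Ideal.mul_mem_right (X 3) _ (Ideal.mul_mem_left _ (X 1) (Ideal.pow_mem_of_mem 𝔮 hX2 2 (by norm_num))))
    rwa [add_sub_cancel_right] at this
  exact ⟨hX0, hX2, ‹𝔮.IsPrime›.mem_or_mem hX13⟩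

/-- **P∞ — the `s`-axis `V(z, u, w)` lies in the top locus**: `f ∈ (z, u, w)³`. [new; elementary] [folklore] -/
theorem Pinf_mem_cube_sAxis :
    (X 0 ^ 3 + X 1 * X 2 ^ 2 * X 3 : MvPolynomial (Fin 4) K) ∈ (Ideal.span {(X 0 : MvPolynomial (Fin 4) K), X 2, X 3}) ^ 3 := by
  have hX0 : (X 0 : MvPolynomial (Fin 4) K) ∈ Ideal.span {(X 0 : MvPolynomial (Fin 4) K), X 2, X 3} := Ideal.subset_span (by simp)
  have hX2 : (X 2 : MvPolynomial (Fin 4) K) ∈ Ideal.span {(X 0 : MvPolynomial (Fin 4) K), X 2, X 3} := Ideal.subset_span (by simp)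
  have hX3 : (X 3 : MvPolynomial (Fin 4) K) ∈ Ideal.span {(X 0 : MvPolynomial (Fin 4) K), X 2, X 3} := Ideal.subset_span (by simp)
  refine Ideal.add_mem _ (Ideal.pow_mem_pow hX0 3) ?_
  have h23 : (X 2 ^ 2 * X 3 : MvPolynomial (Fin 4) K) ∈ (Ideal.span {(X 0 : MvPolynomial (Fin 4) K), X 2, X 3}) ^ (2 + 1) :=
    mul_mem_pow_add (Ideal.pow_mem_pow hX2 2) (by rw [pow_one]; exact hX3)
  rw [mul_assoc]
  exact Ideal.mul_mem_left _ _ h23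

/-- **P∞ — the `w`-axis `V(z, s, u)` lies in the top locus**: `f ∈ (z, s, u)³`. [new; elementary] [folklore] -/
theorem Pinf_mem_cube_wAxis :
    (X 0 ^ 3 + X 1 * X 2 ^ 2 * X 3 : MvPolynomial (Fin 4) K) ∈ (Ideal.span {(X 0 : MvPolynomial (Fin 4) K), X 1, X 2}) ^ 3 := by
  have hX0 : (X 0 : MvPolynomial (Fin 4) K) ∈ Ideal.span {(X 0 : MvPolynomial (Fin 4) K), X 1, X 2} := Ideal.subset_span (by simp)
  have hX1 : (X 1 : MvPolynomial (Fin 4) K) ∈ Ideal.span {(X 0 : MvPolynomial (Fin 4) K), X 1, X 2} := Ideal.subset_span (by simp)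
  have hX2 : (X 2 : MvPolynomial (Fin 4) K) ∈ Ideal.span {(X 0 : MvPolynomial (Fin 4) K), X 1, X 2} := Ideal.subset_span (by simp)
  refine Ideal.add_mem _ (Ideal.pow_mem_pow hX0 3) ?_
  have h12 : (X 1 * X 2 ^ 2 : MvPolynomial (Fin 4) K) ∈ (Ideal.span {(X 0 : MvPolynomial (Fin 4) K), X 1, X 2}) ^ (1 + 2) :=
    mul_mem_pow_add (by rw [pow_one]; exact hX1) (Ideal.pow_mem_pow hX2 2)
  exact Ideal.mul_mem_right _ _ h12

/-- the two axes are LINES (not the origin): `s ∉ (z, u, w)` and `w ∉ (z, s, u)` — the support of P∞ has no isolated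
point. [elementary] [folklore] -/
theorem Pinf_axes_nondegenerate :
    (X 1 : MvPolynomial (Fin 4) K) ∉ Ideal.span {(X 0 : MvPolynomial (Fin 4) K), X 2, X 3} ∧
      (X 3 : MvPolynomial (Fin 4) K) ∉ Ideal.span {(X 0 : MvPolynomial (Fin 4) K), X 1, X 2} := by
  refine ⟨not_mem_span_of_eval _ (fun i => if i = 1 then 1 else 0) ?_ (by simp),
    not_mem_span_of_eval _ (fun i => if i = 3 then 1 else 0) ?_ (by simp)⟩
  · intro g hg
    simp only [Set.mem_insert_iff, Set.mem_singleton_iff] at hg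
    rcases hg with rfl | rfl | rfl <;> simp
  · intro g hg
    simp only [Set.mem_insert_iff, Set.mem_singleton_iff] at hg
    rcases hg with rfl | rfl | rfl <;> simp

/-- **P∞ — WILD at the origin**: `f = z³ + r` with `r = s·u²·w ∈ 𝔫₀⁴` (a `3`-power form: no absolute stalk contact).
[new; elementary] [folklore] -/
theorem Pinf_wild :
    (X 1 * X 2 ^ 2 * X 3 : MvPolynomial (Fin 4) K) ∈ (Ideal.span {(X 0 : MvPolynomial (Fin 4) K), X 1, X 2, X 3}) ^ 4 := by
  have h12 : (X 1 * X 2 ^ 2 : MvPolynomial (Fin 4) K) ∈ (Ideal.span {(X 0 : MvPolynomial (Fin 4) K), X 1, X 2, X 3}) ^ (1 + 2) :=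
    mul_mem_pow_add (by rw [pow_one]; exact X_mem_spanX4 1) (Ideal.pow_mem_pow (X_mem_spanX4 2) 2)
  exact mul_mem_pow_add h12 (by rw [pow_one]; exact X_mem_spanX4 3)

/-- `∂_u∂_u f = 2·(s·w)` — the absolute differential operator of order `2` extracting the tame element along the
axes. [elementary] [folklore] -/
theorem Pinf_dd : (pderiv 2) ((pderiv 2) (X 0 ^ 3 + X 1 * X 2 ^ 2 * X 3 : MvPolynomial (Fin 4) K)) = 2 * (X 1 * X 3) := by
  have e20 := f_ne K (i := 2) (j := 0) (by decide)
  have e21 := f_ne K (i := 2) (j := 1) (by decide)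
  have e23 := f_ne K (i := 2) (j := 3) (by decide)
  have e22 := f_self K 2
  have d2 : pderiv 2 (X 0 ^ 3 + X 1 * X 2 ^ 2 * X 3 : MvPolynomial (Fin 4) K) = 2 * (X 1 * X 2 * X 3) := by
    simp only [map_add, Derivation.leibniz, Derivation.leibniz_pow, smul_eq_mul, nsmul_eq_mul, e20, e21, e22, e23]
    push_cast; ring
  rw [d2]
  simp only [Derivation.leibniz, smul_eq_mul, e21, e22, e23, f_two]
  ring

/-- **P∞ — TAME along the punctured `w`-axis**: at a prime `𝔫 ⊇ (z, s, u)` with `w ∉ 𝔫`, `e = s·w ∈ 𝔫` is a REGULAR PARAMETER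
(`s'·s·w ∈ 𝔫²` ⟹ `∂_s`: `s'·w ∈ 𝔫`, absurd).  With `Pinf_dd`: absolute contact. [new; elementary] [folklore] -/
theorem Pinf_tame_wAxis (𝔫 : Ideal (MvPolynomial (Fin 4) K)) [𝔫.IsPrime] (h1 : (X 1 : MvPolynomial (Fin 4) K) ∈ 𝔫)
    (h3 : (X 3 : MvPolynomial (Fin 4) K) ∉ 𝔫) :
    (X 1 * X 3 : MvPolynomial (Fin 4) K) ∈ 𝔫 ∧ ∀ s' ∉ 𝔫, s' * (X 1 * X 3 : MvPolynomial (Fin 4) K) ∉ 𝔫 ^ 2 := by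
  refine ⟨Ideal.mul_mem_right _ _ h1, fun s' hs' hmem => ?_⟩
  have e13 := f_ne K (i := 1) (j := 3) (by decide)
  have e11 := f_self K 1
  have hD := derivation_pow_succ_mem (pderiv 1 : Derivation K (MvPolynomial (Fin 4) K) _) _ 1 hmem
  rw [pow_one] at hD
  have e : pderiv 1 (s' * (X 1 * X 3) : MvPolynomial (Fin 4) K) = s' * X 3 + X 1 * (X 3 * pderiv 1 s') := by
    rw [Derivation.leibniz, Derivation.leibniz, smul_eq_mul, smul_eq_mul, smul_eq_mul, e11, e13]; ring
  rw [e] at hD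
  have h' : s' * X 3 ∈ 𝔫 := by
    have := Ideal.sub_mem _ hD (Ideal.mul_mem_right (X 3 * pderiv 1 s') _ h1)
    rwa [add_sub_cancel_right] at this
  rcases ‹𝔫.IsPrime›.mem_or_mem h' with h'' | h''
  · exact hs' h''
  · exact h3 h''

/-- **P∞ — TAME along the punctured `s`-axis**: at a prime `𝔫 ⊇ (z, u, w)` with `s ∉ 𝔫`, `e = s·w` is a regular
parameter (`∂_w`).
[new; elementary] [folklore] -/
theorem Pinf_tame_sAxis (𝔫 : Ideal (MvPolynomial (Fin 4) K)) [𝔫.IsPrime] (h3 : (X 3 : MvPolynomial (Fin 4) K) ∈ 𝔫)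
    (h1 : (X 1 : MvPolynomial (Fin 4) K) ∉ 𝔫) :
    (X 1 * X 3 : MvPolynomial (Fin 4) K) ∈ 𝔫 ∧ ∀ s' ∉ 𝔫, s' * (X 1 * X 3 : MvPolynomial (Fin 4) K) ∉ 𝔫 ^ 2 := by
  refine ⟨Ideal.mul_mem_left _ _ h3, fun s' hs' hmem => ?_⟩
  have e31 := f_ne K (i := 3) (j := 1) (by decide)
  have e33 := f_self K 3
  have hD := derivation_pow_succ_mem (pderiv 3 : Derivation K (MvPolynomial (Fin 4) K) _) _ 1 hmem
  rw [pow_one] at hD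
  have e : pderiv 3 (s' * (X 1 * X 3) : MvPolynomial (Fin 4) K) = s' * X 1 + X 3 * (X 1 * pderiv 3 s') := by
    rw [Derivation.leibniz, Derivation.leibniz, smul_eq_mul, smul_eq_mul, smul_eq_mul, e31, e33]; ring
  rw [e] at hD
  have h' : s' * X 1 ∈ 𝔫 := by
    have := Ideal.sub_mem _ hD (Ideal.mul_mem_right (X 1 * pderiv 3 s') _ h3)
    rwa [add_sub_cancel_right] at this
  rcases ‹𝔫.IsPrime›.mem_or_mem h' with h'' | h''
  · exact hs' h''
  · exact h1 h''

/-- **THE REES-CHART SUBSTITUTION** of the blow-up of the origin, chart `x_e`: `x_e ↦ x_e`, `x_j ↦ x_j·x_e (j ≠ e)`.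
DEFINITION (support; a substitution, used only in the machine-checked chart identities). -/
def chartSubst (e : Fin 4) : Fin 4 → MvPolynomial (Fin 4) K := fun j => if j = e then X e else X j * X e

/-- **P∞ REPRODUCES ITSELF in chart `s`**: `f(z's, s, u's, w's) = s³·f(z', s, u', w')`. [new; elementary] [folklore] -/
theorem Pinf_chart_s :
    aeval (chartSubst (K := K) 1) (X 0 ^ 3 + X 1 * X 2 ^ 2 * X 3 : MvPolynomial (Fin 4) K) =
      X 1 ^ 3 * (X 0 ^ 3 + X 1 * X 2 ^ 2 * X 3) := by
  simp [chartSubst]; ring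

/-- **P∞ REPRODUCES ITSELF in chart `w`**: `f(z'w, s'w, u'w, w) = w³·f(z', s', u', w)`. [new; elementary] [folklore] -/
theorem Pinf_chart_w :
    aeval (chartSubst (K := K) 3) (X 0 ^ 3 + X 1 * X 2 ^ 2 * X 3 : MvPolynomial (Fin 4) K) =
      X 3 ^ 3 * (X 0 ^ 3 + X 1 * X 2 ^ 2 * X 3) := by
  simp [chartSubst]; ring

/-- chart `u`: `f(z'u, s'u, u, w'u) = u³·(z'³ + u·s'·w')`. [new; elementary] [folklore] -/
theorem Pinf_chart_u :
    aeval (chartSubst (K := K) 2) (X 0 ^ 3 + X 1 * X 2 ^ 2 * X 3 : MvPolynomial (Fin 4) K) =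
      X 2 ^ 3 * (X 0 ^ 3 + X 1 * X 2 * X 3) := by
  simp [chartSubst]; ring

/-- chart `z`: `f(z, s'z, u'z, w'z) = z³·(1 + z·s'·u'²·w')`. [new; elementary] [folklore] -/
theorem Pinf_chart_z :
    aeval (chartSubst (K := K) 0) (X 0 ^ 3 + X 1 * X 2 ^ 2 * X 3 : MvPolynomial (Fin 4) K) =
      X 0 ^ 3 * (1 + X 0 * X 1 * X 2 ^ 2 * X 3) := by
  simp [chartSubst]; ring

end SepCertificates

end Summit.ResolutionOfSingularities.ResolutionOfSingularities.Theorems.DeltaCutClasses
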